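import Literature.Computability.QuantumComplexity.HidingIdealOracleEvents
import Literature.Computability.QuantumComplexity.HidingStruct
import Literature.Computability.QuantumComplexity.GramSchmidtTableMachine
import HarnessLib

/-!
# The ideal world of the proof of AA13 Thm. 1.3: the good event

Family `quantum-advantage`, sequel of `HidingIdealEvents.lean`, `HidingIdealCore.lean`,
`HidingIdealOracleEvents.lean`, `HidingStruct.lean`. The sample space of the ideal world of the
discharge of Aaronson–Arkhipov's Thm. 1.3 is `Ω = (positions S) × (arrays W) × (counter coins u)`,
all uniform; the GOOD event asks: `S` injective, Gram matrix of `W` near `ms · 1`, perturbation sum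
and planted permanent below their Markov thresholds, discrepancy `Δ_S ≤ θ₂`, and the counter does
not miss when its coins fit (`IdealParams.stockBad` fails; with `ℓ₂ ≥ stockLenB` the coins always
fit, `IdealGood.isApproxCount`).

* `stockCoinLen_le` — **the counter's coin demand is polynomially bounded** (`stockLenB`, an
  encoding-length computation: the hidden matrix code has entries `≤ 2^{b_q}`);
* **`good_answer_bound`** — on GOOD the structured answer `zArr` is accurate:
  `|z/4ᵇ - |Per(X̃/2ᵇ)|²| ≤ Err/4^{bn} + 4^{-b}` (`core_answer_bound` with `q = q_S` the oracle's
  planted mass, `p_S = |Per U_S|²/n!`, `q̃ = Ñ/2^ℓ` the counter's estimate — eqs. (5.79)–(5.95));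
* `IdealGood`, `IdealGood.isApproxCount`, **`card_not_idealGood_le`** — the union bound: the complement of GOOD has fraction at most
  `n²/m + (Gram) + (perturbation) + (permanent) + δ₀/4 + 1/kδS`.

All proved, no new named facts.

## References

* S. Aaronson, A. Arkhipov, *The computational complexity of linear optics*, Theory of Computing 9
  (2013) 143–252, proof of Thm. 1.3, eqs. (5.79)–(5.97) (pp. 193–195).
-/

noncomputable section

namespace Literature.Computability.QuantumComplexity

open Finset Matrix Polynomial Literature.Computability.Complexity Literature.Computability.Complexity.CodeFP
  Literature.Computability.Cryptography Literature.Probability.Distributions Literature.Probability.Moments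
  Literature.LinearAlgebra.Matrix Literature.Analysis.Matrix Literature.Algebra.EuclideanLattices

/-! ### The counter's coin demand is polynomially bounded -/

section Lengths

variable {n e : ℕ}

/-- Bound on the length of the padded query `⟨⟨n, e, b_q, E⟩, 1^{kβ}⟩` when the entries of `E` are
`≤ 2^{b_q}`: with `I = 3(b_q + 5) + 2` (one entry), `R = 2n + 2 + n(2I + 2)` (one row),
`2(2n + 2M + 2b_q + 6 + (2M + 2 + M(2R + 2))) + 2 + kβ`. [folklore] -/
def queryLenB (n M bq kβ : ℕ) : ℕ :=
  2 * (2 * n + 2 * M + 2 * bq + 6 + (2 * M + 2 + M * (2 * (2 * n + 2 + n * (2 * (3 * (bq + 5) + 2) + 2)) + 2))) + 2 + kβ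

/-- Bound on the length of the planted outcome code: `2n + 2 + n(2M + 2)`. [folklore] -/
def outcomeLenB (n M : ℕ) : ℕ := 2 * n + 2 + n * (2 * M + 2)

/-- **Bound on the counter's coin demand** `c_S(|⟨x', S⟩| + ℓ + kη + kδS)`. [folklore] -/
def stockLenB (cO cS : Polynomial ℕ) (n M bq kβ kη kδS : ℕ) : ℕ :=
  cS.eval (2 * queryLenB n M bq kβ + 2 + outcomeLenB n M + cO.eval (queryLenB n M bq kβ) + kη + kδS)

/-- Length of a sign–magnitude integer code. [folklore] -/
theorem length_smE (z : ℤ) : (smE z).length = Nat.size z.natAbs + 4 := by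
  rw [smE_apply, length_boolPair, TM2Pass.length_encodeNat_eq_size, List.length_singleton]
  omega

/-- Length of a sign–magnitude code of a bounded integer. [folklore] -/
theorem length_smE_le {z : ℤ} {bq : ℕ} (h : |z| ≤ 2 ^ bq) : (smE z).length ≤ bq + 5 := by
  rw [length_smE]
  have : z.natAbs < 2 ^ (bq + 1) := by
    have h' : (z.natAbs : ℤ) ≤ 2 ^ bq := by rw [← Int.abs_eq_natAbs]; exact h
    have h'' : z.natAbs ≤ 2 ^ bq := by exact_mod_cast h'
    calc z.natAbs ≤ 2 ^ bq := h''
      _ < 2 ^ (bq + 1) := Nat.pow_lt_pow_right (by norm_num) (by omega)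
  have := Nat.size_le.2 this
  omega

/-- Length of a headed list code with bounded items. [folklore] -/
theorem length_listE_le {α : Type} (e : α → List Bool) {l : List α} {B : ℕ} (h : ∀ a ∈ l, (e a).length ≤ B) :
    (listE e l).length ≤ 2 * l.length + 2 + l.length * (2 * B + 2) := by
  rw [listE, length_boolPair, length_unE]
  have := length_rawE_le_of_forall e h
  omega

/-- **The padded query is short** when the entries of `E` are bounded by `2^{b_q}`. [folklore] -/
theorem length_hidingQuery_le (IP : IdealParams) (E : Fin (n + e) → Fin n → ℤ × ℤ)
    (hE : ∀ r c, |(E r c).1| ≤ 2 ^ IP.b' ∧ |(E r c).2| ≤ 2 ^ IP.b') :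
    (IP.hidingQuery E).length ≤ queryLenB n (n + e) IP.b' IP.kβ := by
  rw [IdealParams.hidingQuery, encode_bosonInput_eq, length_boolPair, length_boolPair, length_boolPair, length_boolPair]
  have hI : ∀ z : ℤ × ℤ, (|z.1| ≤ 2 ^ IP.b' ∧ |z.2| ≤ 2 ^ IP.b') → (pairE smE smE z).length ≤ 3 * (IP.b' + 5) + 2 := by
    intro z hz
    rw [pairE_apply, length_boolPair]
    have h1 := length_smE_le hz.1
    have h2 := length_smE_le hz.2
    omega
  have hrow : ∀ row ∈ rowsOf E, (listE (pairE smE smE) row).length ≤ 2 * n + 2 + n * (2 * (3 * (IP.b' + 5) + 2) + 2) := by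
    intro row hrow
    rw [rowsOf, List.mem_ofFn] at hrow
    obtain ⟨r, rfl⟩ := hrow
    have h := length_listE_le (pairE smE smE) (l := List.ofFn fun c => E r c) (B := 3 * (IP.b' + 5) + 2) fun a ha => by
      rw [List.mem_ofFn] at ha
      obtain ⟨c, rfl⟩ := ha
      exact hI _ (hE r c)
    rw [List.length_ofFn] at h
    exact h
  have hrows := length_listE_le (listE (pairE smE smE)) hrow
  have hlen : (rowsOf E).length = n + e := by simp [rowsOf]
  rw [hlen] at hrows
  have hn : (natE n).length ≤ n := by rw [length_natE]; exact Nat.size_le.2 Nat.lt_two_pow_self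
  have he : (natE e).length ≤ n + e := by
    rw [length_natE]; exact (Nat.size_le.2 Nat.lt_two_pow_self).trans (Nat.le_add_left _ _)
  have hb : (natE IP.b').length ≤ IP.b' := by rw [length_natE]; exact Nat.size_le.2 Nat.lt_two_pow_self
  have hk : (Computability.unaryEncodeNat IP.kβ).length = IP.kβ := length_unE IP.kβ
  unfold queryLenB
  rw [hk]
  omega

/-- The planted outcome code is short. [folklore] -/
theorem length_plantedOutcome_le (ι : Fin n ↪ Fin (n + e)) : (plantedOutcome ι).length ≤ outcomeLenB n (n + e) := by
  rw [plantedOutcome, encodeBosonOutcome_eq_listE]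
  have h := length_listE_le natE (l := List.ofFn fun i => ((ι i : Fin (n + e)) : ℕ)) (B := n + e) fun a ha => by
    rw [List.mem_ofFn] at ha
    obtain ⟨i, rfl⟩ := ha
    rw [length_natE]
    exact (Nat.size_le.2 Nat.lt_two_pow_self).trans (ι i).isLt.le
  rw [List.length_ofFn] at h
  exact h

/-- **The counter's coin demand at the instance `⟨x', S⟩` is at most `stockLenB`** when the entries
of `E` are bounded by `2^{b_q}` (always the case for the machine's `hiddenOf`, `abs_hiddenOf_le`) — an
encoding-length computation on the codes (the demand itself is the coin polynomial of Thm. 4.1's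
counter). [folklore] -/
theorem stockCoinLen_le (IP : IdealParams) (E : Fin (n + e) → Fin n → ℤ × ℤ)
    (hE : ∀ r c, |(E r c).1| ≤ 2 ^ IP.b' ∧ |(E r c).2| ≤ 2 ^ IP.b') (ι : Fin n ↪ Fin (n + e)) :
    IP.stockCoinLen E ι ≤ stockLenB IP.c IP.cS n (n + e) IP.b' IP.kβ IP.kη IP.kδS := by
  unfold IdealParams.stockCoinLen stockLenB IdealParams.oracleCoinLen IdealParams.countInstance
  refine TM2Iter.eval_mono _ ?_
  have hq := length_hidingQuery_le IP E hE
  have ho := length_plantedOutcome_le ι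
  have hl : IP.c.eval (IP.hidingQuery E).length ≤ IP.c.eval (queryLenB n (n + e) IP.b' IP.kβ) := TM2Iter.eval_mono _ hq
  rw [length_boolPair]
  omega

/-- The same for the machine's hidden matrix code `hiddenOf b_q B'`. [folklore] -/
theorem stockCoinLen_hiddenOf_le (IP : IdealParams) (B' : Fin (n + e) → Fin n → ℤ × ℤ) (ι : Fin n ↪ Fin (n + e)) :
    IP.stockCoinLen (hiddenOf IP.b' B') ι ≤ stockLenB IP.c IP.cS n (n + e) IP.b' IP.kβ IP.kη IP.kδS :=
  stockCoinLen_le IP _ (fun r c => abs_hiddenOf_le IP.b' B' r c) ι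

end Lengths

/-! ### On the good event the answer is accurate -/

section IdealGood

variable (IP : IdealParams) (P : PGParams) {n e : ℕ}

/-- **On the good event the structured answer is accurate.** For an array `W` with Gram-good matrix
(`8tn ≤ 1`, `t ≤ 1/4`, `tn < 1`), an injective position `S`, perturbation sum `≤ Z`, planted
permanent `≤ P`, discrepancy `Δ_S ≤ θ₂` (the oracle, Def. 3.11) and a counter estimate within the
factor `1 + 1/kη` (the hypothesis `IsApproxCount`, Thm. 4.1): `|zArr/4ᵇ - |Per(X̃/2ᵇ)|²| ≤ Err/4^{bn} + 4^{-b}` with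
`Err = (2P+Z)Z + (P² + (2P+Z)Z)/kη + n!((1+t) m s)ⁿ θ₂ (1+1/kη)`, `X̃ = W_S` the planted rows.
[cite: AaronsonArkhipovToC2013, proof of Thm. 1.3, eqs. (5.79)–(5.95) (pp. 193–195)] -/
theorem good_answer_bound [NeZero (n + e)] (W : Fin (n + e) → Fin n → EntryBlock P) {S : Fin n → Fin (n + e)}
    (hS : Function.Injective S) (u : List Bool) {t Z Pr θ₂ : ℝ} (hG : GramGood P t (2 * 4 ^ P.b * P.v) W)
    (hs : 0 < 2 * (4 : ℝ) ^ P.b * P.v) (ht0 : 0 ≤ t) (htn : 8 * t * n ≤ 1) (ht4 : t ≤ 1 / 4) (htn' : t * n < 1)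
    (hZ : perturbSum (8 * t) ((yMat P W).submatrix S id) ≤ Z) (hPr : ‖((yMat P W).submatrix S id).permanent‖ ≤ Pr)
    (hkη : 0 < IP.kη) (hΔ : plantedDelta (uMat P W) (lawArr P IP W) ⟨S, hS⟩ ≤ θ₂)
    (hSt : IsApproxCount IP.kη (IP.plantedCount (eArr P IP W) ⟨S, hS⟩) (IP.plantedCountEstimate (eArr P IP W) ⟨S, hS⟩ u)) :
    |(zArr IP.c IP.cS IP.F P.b IP.b' IP.kβ IP.kη IP.kδS (entryArr P W) S u : ℝ) / 4 ^ P.b -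
        ‖(_root_.Matrix.of fun i j => dyadicComplex P.b (entryArr P W (S i) j)).permanent‖ ^ 2| ≤
      ((2 * Pr + Z) * Z + (Pr ^ 2 + (2 * Pr + Z) * Z) / IP.kη +
          n.factorial * ((1 + t) * (((n + e : ℕ) : ℝ) * (2 * 4 ^ P.b * P.v))) ^ n * θ₂ * (1 + 1 / IP.kη)) /
        4 ^ (P.b * n) + 1 / 4 ^ P.b := by
  have hN₀ : 0 < ((n + e : ℕ) : ℝ) * (2 * 4 ^ P.b * P.v) := by
    have : 0 < n + e := Nat.pos_of_ne_zero (NeZero.ne _)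
    positivity
  have hU : IsColumnOrthonormal (uMat P W) := isColumnOrthonormal_uMat P hG hN₀ ht0 htn ht4
  have hkηR : (0 : ℝ) < IP.kη := by exact_mod_cast hkη
  -- the answer as `zOf` of the planted data
  have hz : zArr IP.c IP.cS IP.F P.b IP.b' IP.kβ IP.kη IP.kδS (entryArr P W) S u =
      ((zOf P.b n (IP.plantedCountEstimate (eArr P IP W) ⟨S, hS⟩ u) (IP.oracleCoinLen (eArr P IP W))
        (∏ c : Fin n, dRec (extFamily (entryArr P W)) (2 * c + 1)) (∏ c : Fin n, dRec (extFamily (entryArr P W)) (2 * c)) : ℕ) : ℤ) :=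
    zArr_eq IP P.b (entryArr P W) ⟨S, hS⟩ u
  rw [hz, Int.cast_natCast]
  -- `q = q_S`, `p_S = |Per U_S|²/n!`, `|q - p_S| = Δ_S ≤ θ₂`
  have hq : |IP.idealMass (eArr P IP W) ⟨S, hS⟩ -
      ‖((gsUnit (gaussIntMatrix (entryArr P W))).submatrix S id).permanent‖ ^ 2 / n.factorial| ≤ θ₂ := by
    rw [IdealParams.idealMass_eq_plantedMass, abs_sub_comm]
    have hp := toReal_bosonTargetPMF_plantedOutcome hU ⟨S, hS⟩
    rw [plantedDelta, hp] at hΔ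
    exact hΔ
  -- `|q̃ - q| ≤ q/kη`
  have hqt : |(IP.plantedCountEstimate (eArr P IP W) ⟨S, hS⟩ u : ℝ) / 2 ^ IP.oracleCoinLen (eArr P IP W) -
      IP.idealMass (eArr P IP W) ⟨S, hS⟩| ≤ IP.idealMass (eArr P IP W) ⟨S, hS⟩ / IP.kη := by
    have h := abs_sub_le_of_isApproxCount hkη hSt (L := 2 ^ IP.oracleCoinLen (eArr P IP W)) (by positivity)
    rw [IdealParams.idealMass]
    calc _ ≤ 1 / (IP.kη : ℝ) * ((IP.plantedCount (eArr P IP W) ⟨S, hS⟩ : ℝ) / 2 ^ IP.oracleCoinLen (eArr P IP W)) := h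
      _ = _ := by ring
  exact core_answer_bound P.b (entryArr P W) S hG.hG hN₀ ht0 htn ht4 htn' hZ hPr hkηR hq hqt

end IdealGood

/-! ### The good event and the union bound -/

section Union

variable (IP : IdealParams) (P : PGParams) (n e : ℕ)

/-- The sample space of the ideal world: positions, array, counter coins. [folklore] -/
abbrev IdealΩ : Type := ((Fin n → Fin (n + e)) × (Fin (n + e) → Fin n → EntryBlock P)) × List.Vector Bool IP.ℓ₂

variable {n e}

/-- **The good event**: injective position, Gram-good array, small perturbation sum, small planted
permanent, small discrepancy, and the counter does not miss WHEN ITS COINS FIT (`¬ stockBad`, i.e.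
`stockCoinLen ≤ ℓ₂ → IsApproxCount`; the fit is supplied separately by `ℓ₂ ≥ stockLenB`,
`IdealGood.isApproxCount`). [cite: AaronsonArkhipovToC2013, proof of Thm. 1.3, eq. (5.94) (p. 195)] -/
def IdealGood (t Z Pb θ₂ : ℝ) (q : IdealΩ IP P n e) : Prop :=
  Function.Injective q.1.1 ∧ GramGood P t (2 * 4 ^ P.b * P.v) q.1.2 ∧
    perturbSum (8 * t) ((yMat P q.1.2).submatrix q.1.1 id) < Z ∧
    ‖((yMat P q.1.2).submatrix q.1.1 id).permanent‖ ^ 2 < Pb ∧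
    (∀ h : Function.Injective q.1.1, plantedDelta (uMat P q.1.2) (lawArr P IP q.1.2) ⟨q.1.1, h⟩ ≤ θ₂) ∧
    (∀ h : Function.Injective q.1.1, ¬ IP.stockBad (eArr P IP q.1.2) ⟨q.1.1, h⟩ q.2.toList)

/-- **On the good event the counter is accurate once its coins fit** (`ℓ₂ ≥ stockLenB`, so that
`stockCoinLen ≤ ℓ₂` by `stockCoinLen_hiddenOf_le`). [folklore] -/
theorem IdealGood.isApproxCount {t Z Pb θ₂ : ℝ} {q : IdealΩ IP P n e} (h : IdealGood IP P t Z Pb θ₂ q)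
    (hfit : stockLenB IP.c IP.cS n (n + e) IP.b' IP.kβ IP.kη IP.kδS ≤ IP.ℓ₂) :
    IsApproxCount IP.kη (IP.plantedCount (eArr P IP q.1.2) ⟨q.1.1, h.1⟩)
      (IP.plantedCountEstimate (eArr P IP q.1.2) ⟨q.1.1, h.1⟩ q.2.toList) := by
  by_contra h'
  exact h.2.2.2.2.2 h.1 ⟨(stockCoinLen_hiddenOf_le IP (entryArr P q.1.2) ⟨q.1.1, h.1⟩).trans hfit, h'⟩

open Classical in
/-- **The union bound (eq. (5.94)–(5.95)).** The complement of the good event has fraction at most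
`n²/m + n²·4m(M₄+s²)/(tms)² + 4(8t)²n⁶sⁿn!/Z² + sⁿn!/P_b + δ₀/4 + 1/kδS`, given the oracle's
closeness on Gram-good arrays and the counter's guarantee. [cite: AaronsonArkhipovToC2013, proof of Thm. 1.3, eqs. (5.94)–(5.95) (p. 195)] -/
theorem card_not_idealGood_le {t Z Pb ε₀ δ₀ M4 : ℝ} (ht : 0 < t) (htn3 : 8 * t * (n : ℝ) ^ 3 ≤ 1) (hZ : 0 < Z) (hPb : 0 < Pb)
    (hε : 0 < ε₀) (hδ : 0 ≤ δ₀) (hne : 3 * n ^ 2 ≤ n + e) (hm : 0 < n + e) (hs : 0 < 2 * (4 : ℝ) ^ P.b * P.v)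
    (hM4 : ∑ a, unifW P a * ‖yOf P a‖ ^ 4 = M4) (hδS : 0 < IP.kδS)
    (hO : ∀ W : Fin (n + e) → Fin n → EntryBlock P, GramGood P t (2 * 4 ^ P.b * P.v) W →
      (lawArr P IP W).tvDist (bosonTargetPMF (uMat P W)) ≤ ε₀ * δ₀ / 24)
    (hS : ∀ (x : List Bool) (ℓ : ℕ),
      uniformProb (IP.cS.eval (x.length + ℓ + IP.kη + IP.kδS))
        {u | ¬ IsApproxCount IP.kη (countWitnesses (samplerRel (oracleRandAlg IP.𝒪 IP.c)) ℓ x)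
          (countEstimate IP.F x ℓ IP.kη IP.kδS u)} ≤ 1 / (IP.kδS : ℝ)) :
    ((univ.filter fun q : IdealΩ IP P n e => ¬ IdealGood IP P t Z Pb (ε₀ / 2 / ((n + e : ℕ) : ℝ) ^ n) q).card : ℝ) ≤
      ((n : ℝ) ^ 2 / (n + e : ℕ) +
        (n : ℝ) ^ 2 * (4 * (n + e : ℕ) * (M4 + (2 * 4 ^ P.b * P.v) ^ 2)) / (t * ((n + e : ℕ) * (2 * 4 ^ P.b * P.v))) ^ 2 +
        4 * (8 * t) ^ 2 * (n : ℝ) ^ 6 * ((2 * 4 ^ P.b * P.v) ^ n * n.factorial) / Z ^ 2 +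
        (2 * 4 ^ P.b * P.v) ^ n * n.factorial / Pb + δ₀ / 4 + 1 / (IP.kδS : ℝ)) *
        Fintype.card (IdealΩ IP P n e) := by
  set s : ℝ := 2 * 4 ^ P.b * P.v with hs_def
  set θ₂ : ℝ := ε₀ / 2 / ((n + e : ℕ) : ℝ) ^ n with hθ
  -- the six events on `Ω`
  let A₁ : IdealΩ IP P n e → Prop := fun q => ¬ Function.Injective q.1.1
  let A₂ : IdealΩ IP P n e → Prop := fun q => ¬ GramGood P t s q.1.2
  let A₃ : IdealΩ IP P n e → Prop := fun q => Function.Injective q.1.1 ∧ Z ≤ perturbSum (8 * t) ((yMat P q.1.2).submatrix q.1.1 id)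
  let A₄ : IdealΩ IP P n e → Prop := fun q => Function.Injective q.1.1 ∧ Pb ≤ ‖((yMat P q.1.2).submatrix q.1.1 id).permanent‖ ^ 2
  let A₅ : IdealΩ IP P n e → Prop := fun q => GramGood P t s q.1.2 ∧ DeltaBad P IP θ₂ q.1.2 q.1.1
  let A₆ : IdealΩ IP P n e → Prop := fun q => StockBadS P IP q.1.2 q.1.1 q.2.toList
  have himp : ∀ q : IdealΩ IP P n e, ¬ IdealGood IP P t Z Pb θ₂ q → A₁ q ∨ A₂ q ∨ A₃ q ∨ A₄ q ∨ A₅ q ∨ A₆ q := by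
    intro q hq
    by_cases h1 : Function.Injective q.1.1
    · by_cases h2 : GramGood P t s q.1.2
      · simp only [IdealGood, not_and_or, not_lt, not_forall, not_not] at hq
        rcases hq with h | h | h | h | h | h
        · exact absurd h1 h
        · exact absurd h2 h
        · exact Or.inr (Or.inr (Or.inl ⟨h1, h⟩))
        · exact Or.inr (Or.inr (Or.inr (Or.inl ⟨h1, h⟩)))
        · obtain ⟨h', hΔ⟩ := h
          exact Or.inr (Or.inr (Or.inr (Or.inr (Or.inl ⟨h2, h', not_le.1 hΔ⟩))))
        · obtain ⟨h', hSt⟩ := h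
          exact Or.inr (Or.inr (Or.inr (Or.inr (Or.inr ⟨h', hSt⟩))))
      · exact Or.inr (Or.inl h2)
    · exact Or.inl h1
  -- the six bounds, on `Ω`
  have hB₁ : ((univ.filter A₁).card : ℝ) ≤ (n : ℝ) ^ 2 / (n + e : ℕ) * Fintype.card (IdealΩ IP P n e) := by
    refine card_filter_prod_le_of_snd (fun (p : (Fin n → Fin (n + e)) × (Fin (n + e) → Fin n → EntryBlock P))
      (_ : List.Vector Bool IP.ℓ₂) => ¬ Function.Injective p.1) fun u => ?_
    exact card_not_injective_prod_le (β := Fin (n + e) → Fin n → EntryBlock P) hm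
  have hB₂ : ((univ.filter A₂).card : ℝ) ≤
      (n : ℝ) ^ 2 * (4 * (n + e : ℕ) * (M4 + s ^ 2)) / (t * ((n + e : ℕ) * s)) ^ 2 * Fintype.card (IdealΩ IP P n e) := by
    refine card_filter_prod_le_of_snd (fun (p : (Fin n → Fin (n + e)) × (Fin (n + e) → Fin n → EntryBlock P))
      (_ : List.Vector Bool IP.ℓ₂) => ¬ GramGood P t s p.2) fun u => ?_
    refine card_filter_prod_le_of_fst (fun (_ : Fin n → Fin (n + e)) (W : Fin (n + e) → Fin n → EntryBlock P) =>
      ¬ GramGood P t s W) fun S => ?_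
    exact card_not_gramGood_le P ht hm hs hM4
  have hB₃ : ((univ.filter A₃).card : ℝ) ≤
      4 * (8 * t) ^ 2 * (n : ℝ) ^ 6 * (s ^ n * n.factorial) / Z ^ 2 * Fintype.card (IdealΩ IP P n e) := by
    refine card_filter_prod_le_of_snd (fun (p : (Fin n → Fin (n + e)) × (Fin (n + e) → Fin n → EntryBlock P))
      (_ : List.Vector Bool IP.ℓ₂) => Function.Injective p.1 ∧ Z ≤ perturbSum (8 * t) ((yMat P p.2).submatrix p.1 id)) fun u => ?_
    exact card_inj_perturb_le P (by positivity) (by nlinarith) hZ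
  have hB₄ : ((univ.filter A₄).card : ℝ) ≤ s ^ n * n.factorial / Pb * Fintype.card (IdealΩ IP P n e) := by
    refine card_filter_prod_le_of_snd (fun (p : (Fin n → Fin (n + e)) × (Fin (n + e) → Fin n → EntryBlock P))
      (_ : List.Vector Bool IP.ℓ₂) => Function.Injective p.1 ∧ Pb ≤ ‖((yMat P p.2).submatrix p.1 id).permanent‖ ^ 2) fun u => ?_
    exact card_inj_perm_le P hPb
  have hB₅ : ((univ.filter A₅).card : ℝ) ≤ δ₀ / 4 * Fintype.card (IdealΩ IP P n e) := by
    refine card_filter_prod_le_of_snd (fun (p : (Fin n → Fin (n + e)) × (Fin (n + e) → Fin n → EntryBlock P))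
      (_ : List.Vector Bool IP.ℓ₂) => GramGood P t s p.2 ∧ DeltaBad P IP θ₂ p.2 p.1) fun u => ?_
    exact card_gram_deltaBad_le P IP hε hδ hne hO
  have hB₆ : ((univ.filter A₆).card : ℝ) ≤ 1 / (IP.kδS : ℝ) * Fintype.card (IdealΩ IP P n e) :=
    card_stockBadS_le P IP hδS hS
  -- sum them
  have hsub : (univ.filter fun q : IdealΩ IP P n e => ¬ IdealGood IP P t Z Pb θ₂ q) ⊆
      ((((univ.filter A₁ ∪ univ.filter A₂) ∪ univ.filter A₃) ∪ univ.filter A₄) ∪ univ.filter A₅) ∪ univ.filter A₆ := by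
    intro q hq
    simp only [mem_filter, mem_univ, true_and, mem_union] at hq ⊢
    have := himp q hq
    tauto
  have hU : (univ.filter fun q : IdealΩ IP P n e => ¬ IdealGood IP P t Z Pb θ₂ q).card ≤
      (univ.filter A₁).card + (univ.filter A₂).card + (univ.filter A₃).card + (univ.filter A₄).card +
        (univ.filter A₅).card + (univ.filter A₆).card := by
    have h1 := card_le_card hsub
    have h2 := card_union_le (((((univ.filter A₁ ∪ univ.filter A₂) ∪ univ.filter A₃) ∪ univ.filter A₄) ∪ univ.filter A₅))
      (univ.filter A₆)
    have h3 := card_union_le ((((univ.filter A₁ ∪ univ.filter A₂) ∪ univ.filter A₃) ∪ univ.filter A₄)) (univ.filter A₅)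
    have h4 := card_union_le (((univ.filter A₁ ∪ univ.filter A₂) ∪ univ.filter A₃)) (univ.filter A₄)
    have h5 := card_union_le ((univ.filter A₁ ∪ univ.filter A₂)) (univ.filter A₃)
    have h6 := card_union_le (univ.filter A₁) (univ.filter A₂)
    omega
  have hU' : ((univ.filter fun q : IdealΩ IP P n e => ¬ IdealGood IP P t Z Pb θ₂ q).card : ℝ) ≤
      ((univ.filter A₁).card : ℝ) + (univ.filter A₂).card + (univ.filter A₃).card + (univ.filter A₄).card +
        (univ.filter A₅).card + (univ.filter A₆).card := by
    exact_mod_cast hU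
  refine hU'.trans ?_
  have := add_le_add (add_le_add (add_le_add (add_le_add (add_le_add hB₁ hB₂) hB₃) hB₄) hB₅) hB₆
  refine this.trans (le_of_eq ?_)
  ring

end Union

end Literature.Computability.QuantumComplexity
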